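import Literature.AlgebraicGeometry.Motives.TannakianExternalTensorProductCoefficients
import Literature.AlgebraicGeometry.Motives.TannakianComoduleDual
import Mathlib.RingTheory.HopfAlgebra.TensorProduct
import Mathlib.LinearAlgebra.Contraction
import HarnessLib

/-!
# The dual of an external tensor product: `(V₁ ⊠ V₂)^∨ = V₁^∨ ⊠ V₂^∨` over the Hopf algebra `A₁ ⊗ A₂`
# (Deligne–Milne, *Tannakian categories*, §1 (1.6.7), Prop. 1.9; the antipode of `O(G₁ × G₂) = O(G₁) ⊗ O(G₂)`)

[topic AlgebraicGeometry/Motives]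

Layer `Literature/AlgebraicGeometry/Motives`, lane `lit-hodgefound` (Track 2 foundations library — Layer B source
"Deligne–Milne 1982, *Tannakian categories*" §2; prover seat `lit-hodgefound-p26`, gen 39, row g39-#15). Sequel of
g39-#13 `TannakianExternalTensorProductCoefficients` (`matrixCoeff_extTensor`: the matrix of `V₁ ⊠ V₂` in a product
basis is the Kronecker product; `coord_tensorProduct`) and g33 `TannakianComoduleDual` (`ρ.dual b`: the contragredient
comodule on `V^∨`, matrix `S(aⱼᵢ)` in the dual basis, independent of the basis). Over Mathlib's tensor HOPF algebra
`A₁ ⊗ A₂` (antipode `S ⊗ S` — the inversion of `G₁ × G₂` is factorwise) it proves **`(V₁ ⊠ V₂)^∨ = (V₁^∨ ⊠ V₂^∨)^e`**,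
`e : V₁^∨ ⊗ V₂^∨ ≅ (V₁ ⊗ V₂)^∨` the canonical isomorphism for finite free modules (`dualDistribEquivOfBasis`): on the
dual product basis both structure maps are `vʲ¹ ⊗ wʲ² ↦ Σ (vⁱ¹ ⊗ wⁱ²) ⊗ (S(a_{j₁i₁}) ⊗ S(b_{j₂i₂}))` — a tensor functor
commutes with duals (Deligne–Milne Prop. 1.9 for `⊠`, here by the explicit matrices). THEOREMS only; no definition,
no named fact (net debt `0`), no `instance`, no notation, no sorry.

## The source, verbatim

P. Deligne, J. S. Milne, *Tannakian categories*, LNM 900 (1982) [DeligneMilne1982Tannakian], §1: (1.6.5) «The dual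
`X^∨` of an object `X` is defined to be `Hom(X, 1)`»; (1.6.7) «`f^∨ = (ᵗf)⁻¹ : X^∨ → Y^∨`»; Prop. 1.9 «Let `(F, c)` be a
tensor functor … `F(X^∨) = F(X)^∨`» (tensor functors preserve duals); §2 Prop. 2.2 and p. 108 («inverse: `G → G` …
induce … `S`»). J. S. Milne, *Algebraic Groups* (2017) [Milne2017], Ch. 2 §e 2.30 «`O(G_1 × ⋯ × G_n) ≃ O(G_1) ⊗ ⋯ ⊗
O(G_n)`».

READING (recorded). `R` a commutative semiring, `A₁`, `A₂` Hopf algebras, `A₁ ⊗ A₂` Mathlib's tensor Hopf algebra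
(`S(a ⊗ b) = S(a) ⊗ S(b)`); `(Vᵢ, ρᵢ)` comodules with finite bases `b₁`, `b₂`; `V^∨ = ρ.dual b` has matrix `S(aⱼᵢ)` on
the dual basis (g33 `dual_dualBasis`). The dual basis of `b₁ ⊗ b₂` is `e(b₁^* ⊗ b₂^*)` (g39-#13 `coord_tensorProduct`);
the matrix of `V₁ ⊠ V₂` is the Kronecker product (g39-#13), so `((V₁ ⊠ V₂)^∨)(e(vʲ¹ ⊗ wʲ²)) = Σ_{(i₁,i₂)} e(vⁱ¹ ⊗ wⁱ²) ⊗
S(a_{j₁i₁} ⊗ b_{j₂i₂})`, which is `(e ⊗ id)` of `(V₁^∨ ⊠ V₂^∨)(vʲ¹ ⊗ wʲ²) = Σᵢ₁ Σᵢ₂ (vⁱ¹ ⊗ wⁱ²) ⊗ (S a_{j₁i₁} ⊗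
S b_{j₂i₂})`: **`(ρ₁ ⊠ ρ₂)^∨ = (ρ₁^∨ ⊠ ρ₂^∨)^e`** and `e` is an isomorphism of `G₁ × G₂`-modules `V₁^∨ ⊠ V₂^∨ ≅
(V₁ ⊠ V₂)^∨`.

## Contents (namespace `Literature.AlgebraicGeometry.Motives.Tannakian.Coaction`)

* `dualDistribEquivOfBasis_dualBasis_tmul` (`e(vⁱ¹ ⊗ wⁱ²) = (v ⊗ w)^{(i₁,i₂)}`), **`dual_extTensor`**
  (`(ρ₁.extTensor ρ₂).dual (b₁.tensorProduct b₂) = ((ρ₁.dual b₁).extTensor (ρ₂.dual b₂)).congr e`),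
  **`isHom_dualDistribEquivOfBasis`** (`e : V₁^∨ ⊠ V₂^∨ → (V₁ ⊠ V₂)^∨` is an isomorphism of representations).

## References

* [DeligneMilne1982Tannakian] P. Deligne, J. S. Milne, *Tannakian categories*, in LNM 900, Springer (1982): §1
  (1.6.5)–(1.6.7), Prop. 1.9; §2 Prop. 2.2, p. 108.
* [Milne2017] J. S. Milne, *Algebraic Groups*, CUP (2017): Ch. 2 §e 2.30.
-/

noncomputable section

namespace Literature.AlgebraicGeometry.Motives.Tannakian

namespace Coaction

open TensorProduct Coalgebra HopfAlgebra

universe u v v' w w'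

section Hopf

variable {R : Type u} {A₁ : Type v} {A₂ : Type v'} {V₁ : Type w} {V₂ : Type w'} [CommSemiring R]
  [Semiring A₁] [HopfAlgebra R A₁] [Semiring A₂] [HopfAlgebra R A₂]
  [AddCommMonoid V₁] [Module R V₁] [AddCommMonoid V₂] [Module R V₂]
  {ι₁ ι₂ : Type*} [Fintype ι₁] [Fintype ι₂] [DecidableEq ι₁] [DecidableEq ι₂]

omit [Semiring A₁] [HopfAlgebra R A₁] [Semiring A₂] [HopfAlgebra R A₂] in
/-- **`e(vⁱ¹ ⊗ wⁱ²) = (v ⊗ w)^{(i₁,i₂)}`**: the canonical `e : V₁^∨ ⊗ V₂^∨ ≅ (V₁ ⊗ V₂)^∨` carries the tensor of the dual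
bases to the dual basis of the product basis. [cite: DeligneMilne1982Tannakian, §1 (1.6.5)–(1.6.7) (duals in a rigid
tensor category)] -/
theorem dualDistribEquivOfBasis_dualBasis_tmul (b₁ : Module.Basis ι₁ R V₁) (b₂ : Module.Basis ι₂ R V₂) (i₁ : ι₁)
    (i₂ : ι₂) :
    TensorProduct.dualDistribEquivOfBasis b₁ b₂ (b₁.dualBasis i₁ ⊗ₜ[R] b₂.dualBasis i₂) =
      (b₁.tensorProduct b₂).dualBasis (i₁, i₂) := by
  rw [Module.Basis.coe_dualBasis, Module.Basis.coe_dualBasis, Module.Basis.coe_dualBasis, coord_tensorProduct]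
  rfl

/-- **`(V₁ ⊠ V₂)^∨ = (V₁^∨ ⊠ V₂^∨)^e`**: the contragredient of an external tensor product over the Hopf algebra `A₁ ⊗ A₂`
(antipode `S ⊗ S`) is the external tensor product of the contragredients, transported along `e : V₁^∨ ⊗ V₂^∨ ≅
(V₁ ⊗ V₂)^∨` — on the dual product basis both have the matrix `(S(a_{j₁i₁}) ⊗ S(b_{j₂i₂}))`, the Kronecker product of
the contragredient matrices. [cite: DeligneMilne1982Tannakian, §1 (1.6.7) («f^∨ = (ᵗf)⁻¹»), Prop. 1.9 («F(X^∨) =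
F(X)^∨» for a tensor functor); Milne2017, Ch. 2 §e 2.30] -/
theorem dual_extTensor (ρ₁ : Coaction R A₁ V₁) (ρ₂ : Coaction R A₂ V₂) (b₁ : Module.Basis ι₁ R V₁)
    (b₂ : Module.Basis ι₂ R V₂) :
    (ρ₁.extTensor ρ₂).dual (b₁.tensorProduct b₂) =
      ((ρ₁.dual b₁).extTensor (ρ₂.dual b₂)).congr (TensorProduct.dualDistribEquivOfBasis b₁ b₂) := by
  refine Coaction.ext ((b₁.tensorProduct b₂).dualBasis.ext fun j => ?_)
  obtain ⟨j₁, j₂⟩ := j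
  rw [dual_dualBasis, congr_apply, ← dualDistribEquivOfBasis_dualBasis_tmul, LinearEquiv.symm_apply_apply,
    extTensor_tmul_of_eq_sum _ _ (ρ₁.dual_dualBasis b₁ j₁) (ρ₂.dual_dualBasis b₂ j₂), Fintype.sum_prod_type]
  simp only [map_sum, LinearMap.rTensor_tmul, LinearEquiv.coe_coe, dualDistribEquivOfBasis_dualBasis_tmul,
    matrixCoeff_extTensor, TensorProduct.antipode_def, TensorProduct.AlgebraTensorModule.map_tmul]

/-- **`e : V₁^∨ ⊠ V₂^∨ → (V₁ ⊠ V₂)^∨` is an isomorphism of representations of `G₁ × G₂`.** [cite: DeligneMilne1982Tannakian,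
§1 Prop. 1.9 («F(X^∨) = F(X)^∨»), (1.6.7)] -/
theorem isHom_dualDistribEquivOfBasis (ρ₁ : Coaction R A₁ V₁) (ρ₂ : Coaction R A₂ V₂) (b₁ : Module.Basis ι₁ R V₁)
    (b₂ : Module.Basis ι₂ R V₂) :
    ((ρ₁.dual b₁).extTensor (ρ₂.dual b₂)).IsHom ((ρ₁.extTensor ρ₂).dual (b₁.tensorProduct b₂))
      (TensorProduct.dualDistribEquivOfBasis b₁ b₂).toLinearMap := by
  rw [dual_extTensor]
  exact ((ρ₁.dual b₁).extTensor (ρ₂.dual b₂)).isHom_congr _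

end Hopf

end Coaction

end Literature.AlgebraicGeometry.Motives.Tannakian
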